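import Summits.Ventures.PackingBounds.Configurations.E8Basis

/-!
# Half-integral coordinates for `240`-point kissing configurations of `ℝ⁸` (Bannai–Sloane, step (ii), part 6)

Framing: lottery ticket; floor = certified bounds/negative ranges. Venture `PackingBounds` (cell
`pub-packcert`, seat `pub-packcert-energy`).

Let `C ⊂ S⁷` be a kissing configuration with `|C| = 240`. From the `D₄`-frame `a, b, c, e`
(`E8Frame.exists_frame`) and its glue system `y₁, …, y₄, x'` (`E8Basis.exists_glue_system`) we form
`f = (a, b, c, e, y₁ + y₂ - a - b, y₁ - y₂, y₃ + y₄ - a - b, y₃ - y₄)`.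
The known inner products make `f` ORTHONORMAL (`orthonormal_frame`), every `2⟨f_k, y⟩` (`y ∈ C`) is an
integer (all `f_k` are `ℤ`-combinations of points of `C`, and `2⟨z, y⟩ ∈ ℤ` on `C`), and the four vectors
`f₀+f₁+f₂+f₃ = 2d`, `f₀+f₁+f₄+f₅ = 2y₁`, `f₀+f₁+f₆+f₇ = 2y₃`, `f₀+f₂+f₄+f₆ = 2x'` (the last by a norm-zero
computation, `two_smul_x_eq`) have INTEGER inner products with every point of `C`. Packaged as
`exists_halfIntegralBasis`, this is the coordinate system in which `E8Unique.lean` identifies `C` with the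
Hamming-code model of the `E₈` root system.

## References
* E. Bannai, N. J. A. Sloane, Canad. J. Math. 33 (1981) 437–449 (= Conway–Sloane, *SPLAG*, Ch. 14, Thm. 7–8). [`ConwaySloane1999`]
-/

namespace Summit.Ventures.PackingBounds.Config.E8Coords

open Finset

section glue

/-! ### Pure inner-product computations for a frame with glue system -/

variable {a b c e y₁ y₂ y₃ y₄ x' : EuclideanSpace ℝ (Fin 8)}
  (haa : inner ℝ a a = 1) (hbb : inner ℝ b b = 1) (hcc : inner ℝ c c = 1) (hee : inner ℝ e e = 1)
  (h11 : inner ℝ y₁ y₁ = 1) (h22 : inner ℝ y₂ y₂ = 1) (h33 : inner ℝ y₃ y₃ = 1) (h44 : inner ℝ y₄ y₄ = 1)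
  (hxx : inner ℝ x' x' = 1)
  (hab : inner ℝ a b = 0) (hac : inner ℝ a c = 0) (hae : inner ℝ a e = 0) (hbc : inner ℝ b c = 0)
  (hbe : inner ℝ b e = 0) (hce : inner ℝ c e = 0)
  (ha1 : inner ℝ a y₁ = 1 / 2) (hb1 : inner ℝ b y₁ = 1 / 2) (hc1 : inner ℝ c y₁ = 0) (he1 : inner ℝ e y₁ = 0)
  (ha2 : inner ℝ a y₂ = 1 / 2) (hb2 : inner ℝ b y₂ = 1 / 2) (hc2 : inner ℝ c y₂ = 0) (he2 : inner ℝ e y₂ = 0)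
  (ha3 : inner ℝ a y₃ = 1 / 2) (hb3 : inner ℝ b y₃ = 1 / 2) (hc3 : inner ℝ c y₃ = 0) (he3 : inner ℝ e y₃ = 0)
  (ha4 : inner ℝ a y₄ = 1 / 2) (hb4 : inner ℝ b y₄ = 1 / 2) (hc4 : inner ℝ c y₄ = 0) (he4 : inner ℝ e y₄ = 0)
  (hax : inner ℝ a x' = 1 / 2) (hcx : inner ℝ c x' = 1 / 2) (hbx : inner ℝ b x' = 0)
  (h12 : inner ℝ y₁ y₂ = 1 / 2) (h13 : inner ℝ y₁ y₃ = 1 / 2) (h14 : inner ℝ y₁ y₄ = 1 / 2)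
  (h23 : inner ℝ y₂ y₃ = 1 / 2) (h24 : inner ℝ y₂ y₄ = 1 / 2) (h34 : inner ℝ y₃ y₄ = 1 / 2)
  (hx1 : inner ℝ x' y₁ = 1 / 2) (hx2 : inner ℝ x' y₂ = 1 / 2) (hx3 : inner ℝ x' y₃ = 1 / 2)
  (hx4 : inner ℝ x' y₄ = 1 / 2)
include haa hbb hcc hee h11 h22 h33 h44 hab hac hae hbc hbe hce ha1 hb1 hc1 he1 ha2 hb2 hc2 he2 ha3 hb3
  hc3 he3 ha4 hb4 hc4 he4 h12 h13 h14 h23 h24 h34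

/-- The frame-with-glue vectors `(a, b, c, e, y₁ + y₂ - a - b, y₁ - y₂, y₃ + y₄ - a - b, y₃ - y₄)` are
orthonormal. -/
theorem orthonormal_frame :
    Orthonormal ℝ ![a, b, c, e, y₁ + y₂ - (a + b), y₁ - y₂, y₃ + y₄ - (a + b), y₃ - y₄] := by
  have hba : inner ℝ b a = 0 := by rw [real_inner_comm]; exact hab
  have hca : inner ℝ c a = 0 := by rw [real_inner_comm]; exact hac
  have hea : inner ℝ e a = 0 := by rw [real_inner_comm]; exact hae
  have hcb : inner ℝ c b = 0 := by rw [real_inner_comm]; exact hbc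
  have heb : inner ℝ e b = 0 := by rw [real_inner_comm]; exact hbe
  have hec : inner ℝ e c = 0 := by rw [real_inner_comm]; exact hce
  have h1a : inner ℝ y₁ a = 1 / 2 := by rw [real_inner_comm]; exact ha1
  have h1b : inner ℝ y₁ b = 1 / 2 := by rw [real_inner_comm]; exact hb1
  have h1c : inner ℝ y₁ c = 0 := by rw [real_inner_comm]; exact hc1
  have h1e : inner ℝ y₁ e = 0 := by rw [real_inner_comm]; exact he1
  have h2a : inner ℝ y₂ a = 1 / 2 := by rw [real_inner_comm]; exact ha2
  have h2b : inner ℝ y₂ b = 1 / 2 := by rw [real_inner_comm]; exact hb2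
  have h2c : inner ℝ y₂ c = 0 := by rw [real_inner_comm]; exact hc2
  have h2e : inner ℝ y₂ e = 0 := by rw [real_inner_comm]; exact he2
  have h3a : inner ℝ y₃ a = 1 / 2 := by rw [real_inner_comm]; exact ha3
  have h3b : inner ℝ y₃ b = 1 / 2 := by rw [real_inner_comm]; exact hb3
  have h3c : inner ℝ y₃ c = 0 := by rw [real_inner_comm]; exact hc3
  have h3e : inner ℝ y₃ e = 0 := by rw [real_inner_comm]; exact he3
  have h4a : inner ℝ y₄ a = 1 / 2 := by rw [real_inner_comm]; exact ha4
  have h4b : inner ℝ y₄ b = 1 / 2 := by rw [real_inner_comm]; exact hb4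
  have h4c : inner ℝ y₄ c = 0 := by rw [real_inner_comm]; exact hc4
  have h4e : inner ℝ y₄ e = 0 := by rw [real_inner_comm]; exact he4
  have h21 : inner ℝ y₂ y₁ = 1 / 2 := by rw [real_inner_comm]; exact h12
  have h31 : inner ℝ y₃ y₁ = 1 / 2 := by rw [real_inner_comm]; exact h13
  have h41 : inner ℝ y₄ y₁ = 1 / 2 := by rw [real_inner_comm]; exact h14
  have h32 : inner ℝ y₃ y₂ = 1 / 2 := by rw [real_inner_comm]; exact h23
  have h42 : inner ℝ y₄ y₂ = 1 / 2 := by rw [real_inner_comm]; exact h24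
  have h43 : inner ℝ y₄ y₃ = 1 / 2 := by rw [real_inner_comm]; exact h34
  rw [orthonormal_iff_ite]
  simp only [Fin.forall_fin_succ, IsEmpty.forall_iff, Matrix.cons_val_zero, Matrix.cons_val_succ,
    and_true, Fin.succ_inj, Fin.succ_ne_zero, (Fin.succ_ne_zero _).symm, if_true, if_false,
    inner_add_left, inner_add_right, inner_sub_left, inner_sub_right,
    haa, hbb, hcc, hee, h11, h22, h33, h44, hab, hac, hae, hbc, hbe, hce, hba, hca, hea, hcb, heb, hec,
    ha1, hb1, hc1, he1, ha2, hb2, hc2, he2, ha3, hb3, hc3, he3, ha4, hb4, hc4, he4,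
    h1a, h1b, h1c, h1e, h2a, h2b, h2c, h2e, h3a, h3b, h3c, h3e, h4a, h4b, h4c, h4e,
    h12, h13, h14, h23, h24, h34, h21, h31, h41, h32, h42, h43]
  norm_num

include hxx hax hcx hbx hx1 hx2 hx3 hx4 in
omit hee hae hbe hce he1 he2 he3 he4 in
/-- The transposed pattern point is determined: `2x' = y₁ + y₂ + y₃ + y₄ - a - 2b + c`
(its glue component is the half-sum of the four orthogonal glue vectors). -/
theorem two_smul_x_eq : (2 : ℝ) • x' = y₁ + y₂ + y₃ + y₄ - a - (2 : ℝ) • b + c := by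
  have hba : inner ℝ b a = 0 := by rw [real_inner_comm]; exact hab
  have hca : inner ℝ c a = 0 := by rw [real_inner_comm]; exact hac
  have hcb : inner ℝ c b = 0 := by rw [real_inner_comm]; exact hbc
  have h1a : inner ℝ y₁ a = 1 / 2 := by rw [real_inner_comm]; exact ha1
  have h1b : inner ℝ y₁ b = 1 / 2 := by rw [real_inner_comm]; exact hb1
  have h1c : inner ℝ y₁ c = 0 := by rw [real_inner_comm]; exact hc1
  have h2a : inner ℝ y₂ a = 1 / 2 := by rw [real_inner_comm]; exact ha2
  have h2b : inner ℝ y₂ b = 1 / 2 := by rw [real_inner_comm]; exact hb2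
  have h2c : inner ℝ y₂ c = 0 := by rw [real_inner_comm]; exact hc2
  have h3a : inner ℝ y₃ a = 1 / 2 := by rw [real_inner_comm]; exact ha3
  have h3b : inner ℝ y₃ b = 1 / 2 := by rw [real_inner_comm]; exact hb3
  have h3c : inner ℝ y₃ c = 0 := by rw [real_inner_comm]; exact hc3
  have h4a : inner ℝ y₄ a = 1 / 2 := by rw [real_inner_comm]; exact ha4
  have h4b : inner ℝ y₄ b = 1 / 2 := by rw [real_inner_comm]; exact hb4
  have h4c : inner ℝ y₄ c = 0 := by rw [real_inner_comm]; exact hc4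
  have h21 : inner ℝ y₂ y₁ = 1 / 2 := by rw [real_inner_comm]; exact h12
  have h31 : inner ℝ y₃ y₁ = 1 / 2 := by rw [real_inner_comm]; exact h13
  have h41 : inner ℝ y₄ y₁ = 1 / 2 := by rw [real_inner_comm]; exact h14
  have h32 : inner ℝ y₃ y₂ = 1 / 2 := by rw [real_inner_comm]; exact h23
  have h42 : inner ℝ y₄ y₂ = 1 / 2 := by rw [real_inner_comm]; exact h24
  have h43 : inner ℝ y₄ y₃ = 1 / 2 := by rw [real_inner_comm]; exact h34
  have hxa : inner ℝ x' a = 1 / 2 := by rw [real_inner_comm]; exact hax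
  have hxc : inner ℝ x' c = 1 / 2 := by rw [real_inner_comm]; exact hcx
  have hxb : inner ℝ x' b = 0 := by rw [real_inner_comm]; exact hbx
  have h1x : inner ℝ y₁ x' = 1 / 2 := by rw [real_inner_comm]; exact hx1
  have h2x : inner ℝ y₂ x' = 1 / 2 := by rw [real_inner_comm]; exact hx2
  have h3x : inner ℝ y₃ x' = 1 / 2 := by rw [real_inner_comm]; exact hx3
  have h4x : inner ℝ y₄ x' = 1 / 2 := by rw [real_inner_comm]; exact hx4
  have hz : inner ℝ ((2 : ℝ) • x' - (y₁ + y₂ + y₃ + y₄ - a - (2 : ℝ) • b + c))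
      ((2 : ℝ) • x' - (y₁ + y₂ + y₃ + y₄ - a - (2 : ℝ) • b + c)) = 0 := by
    simp only [inner_add_left, inner_add_right, inner_sub_left, inner_sub_right, inner_smul_left,
      inner_smul_right, RCLike.conj_to_real,
      haa, hbb, hcc, h11, h22, h33, h44, hxx, hab, hac, hbc, hba, hca, hcb,
      ha1, hb1, hc1, ha2, hb2, hc2, ha3, hb3, hc3, ha4, hb4, hc4,
      h1a, h1b, h1c, h2a, h2b, h2c, h3a, h3b, h3c, h4a, h4b, h4c,
      h12, h13, h14, h23, h24, h34, h21, h31, h41, h32, h42, h43,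
      hax, hcx, hbx, hxa, hxc, hxb, hx1, hx2, hx3, hx4, h1x, h2x, h3x, h4x]
    norm_num
  rw [real_inner_self_eq_norm_sq, sq_eq_zero_iff, norm_eq_zero, sub_eq_zero] at hz
  exact hz

end glue

section config

variable {C : Finset (EuclideanSpace ℝ (Fin 8))} (h1 : ∀ x ∈ C, ‖x‖ = 1)
  (h2 : ∀ x ∈ C, ∀ y ∈ C, x ≠ y → inner ℝ x y ≤ 1 / 2) (hcard : C.card = 240)
include h1 h2 hcard

/-- **Half-integral orthonormal basis.** Every `240`-point kissing configuration `C ⊂ S⁷` admits eight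
orthonormal vectors `f₀, …, f₇` such that every `2⟨f_k, y⟩` (`y ∈ C`) is an integer and the four vectors
`f₀+f₁+f₂+f₃`, `f₀+f₁+f₄+f₅`, `f₀+f₁+f₆+f₇`, `f₀+f₂+f₄+f₆` (the generators of the `[8,4,4]` Hamming code
pattern of `E₈`) have integer inner products with all of `C`. [cite: ConwaySloane1999, Ch. 14 Thm. 7] -/
theorem exists_halfIntegralBasis : ∃ f : Fin 8 → EuclideanSpace ℝ (Fin 8), Orthonormal ℝ f ∧
    (∀ y ∈ C, ∀ k, ∃ m : ℤ, 2 * inner ℝ (f k) y = m) ∧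
    (∀ y ∈ C, ∃ m : ℤ, inner ℝ (f 0 + f 1 + f 2 + f 3) y = m) ∧
    (∀ y ∈ C, ∃ m : ℤ, inner ℝ (f 0 + f 1 + f 4 + f 5) y = m) ∧
    (∀ y ∈ C, ∃ m : ℤ, inner ℝ (f 0 + f 1 + f 6 + f 7) y = m) ∧
    (∀ y ∈ C, ∃ m : ℤ, inner ℝ (f 0 + f 2 + f 4 + f 6) y = m) := by
  obtain ⟨a, ha, b, hb, c, hc, e, he, d, hd, hab, hac, hae, hbc, hbe, hce, hdsum⟩ :=
    E8Frame.exists_frame h1 h2 hcard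
  obtain ⟨y₁, hy₁, y₂, hy₂, y₃, hy₃, y₄, hy₄, x', hx', q₁, q₂, q₃, q₄, qx, ⟨h12, h13, h14, h23, h24, h34⟩,
    ⟨hx1, hx2, hx3, hx4⟩⟩ :=
    E8Basis.exists_glue_system h1 h2 hcard ha hb hc he hd hab hac hae hbc hbe hce hdsum
  have nsq : ∀ z ∈ C, inner ℝ z z = 1 := fun z hz => by
    rw [real_inner_self_eq_norm_sq, h1 z hz, one_pow]
  -- integrality of `2⟨z, y⟩` on `C`
  have hint : ∀ z ∈ C, ∀ y ∈ C, ∃ m : ℤ, 2 * inner ℝ z y = m := fun z hz y hy =>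
    E8Closure.exists_int_two_mul_inner h1 h2 hcard hz hy
  refine ⟨![a, b, c, e, y₁ + y₂ - (a + b), y₁ - y₂, y₃ + y₄ - (a + b), y₃ - y₄], ?_, ?_, ?_, ?_, ?_, ?_⟩
  · exact orthonormal_frame (nsq a ha) (nsq b hb) (nsq c hc) (nsq e he) (nsq y₁ hy₁) (nsq y₂ hy₂)
      (nsq y₃ hy₃) (nsq y₄ hy₄) hab hac hae hbc hbe hce q₁.1 q₁.2.1 q₁.2.2.1 q₁.2.2.2 q₂.1 q₂.2.1 q₂.2.2.1
      q₂.2.2.2 q₃.1 q₃.2.1 q₃.2.2.1 q₃.2.2.2 q₄.1 q₄.2.1 q₄.2.2.1 q₄.2.2.2 h12 h13 h14 h23 h24 h34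
  · intro y hy k
    obtain ⟨ma, hma⟩ := hint a ha y hy
    obtain ⟨mb, hmb⟩ := hint b hb y hy
    obtain ⟨mc, hmc⟩ := hint c hc y hy
    obtain ⟨me, hme⟩ := hint e he y hy
    obtain ⟨m1, hm1⟩ := hint y₁ hy₁ y hy
    obtain ⟨m2, hm2⟩ := hint y₂ hy₂ y hy
    obtain ⟨m3, hm3⟩ := hint y₃ hy₃ y hy
    obtain ⟨m4, hm4⟩ := hint y₄ hy₄ y hy
    fin_cases k
    · exact ⟨ma, by simpa using hma⟩
    · exact ⟨mb, by simpa using hmb⟩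
    · exact ⟨mc, by simpa using hmc⟩
    · exact ⟨me, by simpa using hme⟩
    · refine ⟨m1 + m2 - ma - mb, ?_⟩
      simp only [Fin.reduceFinMk, Matrix.cons_val, inner_sub_left, inner_add_left]
      push_cast
      linarith
    · refine ⟨m1 - m2, ?_⟩
      simp only [Fin.reduceFinMk, Matrix.cons_val, inner_sub_left]
      push_cast
      linarith
    · refine ⟨m3 + m4 - ma - mb, ?_⟩
      simp only [Fin.reduceFinMk, Matrix.cons_val, inner_sub_left, inner_add_left]
      push_cast
      linarith
    · refine ⟨m3 - m4, ?_⟩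
      simp only [Fin.reduceFinMk, Matrix.cons_val, inner_sub_left]
      push_cast
      linarith
  · intro y hy
    obtain ⟨m, hm⟩ := hint d hd y hy
    refine ⟨m, ?_⟩
    have hsum : (![a, b, c, e, y₁ + y₂ - (a + b), y₁ - y₂, y₃ + y₄ - (a + b), y₃ - y₄] 0 +
        ![a, b, c, e, y₁ + y₂ - (a + b), y₁ - y₂, y₃ + y₄ - (a + b), y₃ - y₄] 1 +
        ![a, b, c, e, y₁ + y₂ - (a + b), y₁ - y₂, y₃ + y₄ - (a + b), y₃ - y₄] 2 +
        ![a, b, c, e, y₁ + y₂ - (a + b), y₁ - y₂, y₃ + y₄ - (a + b), y₃ - y₄] 3 :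
        EuclideanSpace ℝ (Fin 8)) = (2 : ℝ) • d := by
      simp only [Matrix.cons_val_zero, Matrix.cons_val_one, Matrix.cons_val]
      rw [hdsum, smul_smul]; norm_num
    rw [hsum, inner_smul_left, RCLike.conj_to_real, hm]
  · intro y hy
    obtain ⟨m, hm⟩ := hint y₁ hy₁ y hy
    refine ⟨m, ?_⟩
    have hsum : (![a, b, c, e, y₁ + y₂ - (a + b), y₁ - y₂, y₃ + y₄ - (a + b), y₃ - y₄] 0 +
        ![a, b, c, e, y₁ + y₂ - (a + b), y₁ - y₂, y₃ + y₄ - (a + b), y₃ - y₄] 1 +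
        ![a, b, c, e, y₁ + y₂ - (a + b), y₁ - y₂, y₃ + y₄ - (a + b), y₃ - y₄] 4 +
        ![a, b, c, e, y₁ + y₂ - (a + b), y₁ - y₂, y₃ + y₄ - (a + b), y₃ - y₄] 5 :
        EuclideanSpace ℝ (Fin 8)) = (2 : ℝ) • y₁ := by
      simp only [Matrix.cons_val_zero, Matrix.cons_val_one, Matrix.cons_val]
      rw [two_smul]; abel
    rw [hsum, inner_smul_left, RCLike.conj_to_real, hm]
  · intro y hy
    obtain ⟨m, hm⟩ := hint y₃ hy₃ y hy
    refine ⟨m, ?_⟩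
    have hsum : (![a, b, c, e, y₁ + y₂ - (a + b), y₁ - y₂, y₃ + y₄ - (a + b), y₃ - y₄] 0 +
        ![a, b, c, e, y₁ + y₂ - (a + b), y₁ - y₂, y₃ + y₄ - (a + b), y₃ - y₄] 1 +
        ![a, b, c, e, y₁ + y₂ - (a + b), y₁ - y₂, y₃ + y₄ - (a + b), y₃ - y₄] 6 +
        ![a, b, c, e, y₁ + y₂ - (a + b), y₁ - y₂, y₃ + y₄ - (a + b), y₃ - y₄] 7 :
        EuclideanSpace ℝ (Fin 8)) = (2 : ℝ) • y₃ := by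
      simp only [Matrix.cons_val_zero, Matrix.cons_val_one, Matrix.cons_val]
      rw [two_smul]; abel
    rw [hsum, inner_smul_left, RCLike.conj_to_real, hm]
  · intro y hy
    obtain ⟨m, hm⟩ := hint x' hx' y hy
    refine ⟨m, ?_⟩
    have h2x := two_smul_x_eq (nsq a ha) (nsq b hb) (nsq c hc) (nsq y₁ hy₁) (nsq y₂ hy₂) (nsq y₃ hy₃)
      (nsq y₄ hy₄) (nsq x' hx') hab hac hbc q₁.1 q₁.2.1 q₁.2.2.1 q₂.1 q₂.2.1 q₂.2.2.1 q₃.1 q₃.2.1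
      q₃.2.2.1 q₄.1 q₄.2.1 q₄.2.2.1 qx.1 qx.2.1 qx.2.2.1 h12 h13 h14 h23 h24 h34 hx1 hx2 hx3 hx4
    have hsum : (![a, b, c, e, y₁ + y₂ - (a + b), y₁ - y₂, y₃ + y₄ - (a + b), y₃ - y₄] 0 +
        ![a, b, c, e, y₁ + y₂ - (a + b), y₁ - y₂, y₃ + y₄ - (a + b), y₃ - y₄] 2 +
        ![a, b, c, e, y₁ + y₂ - (a + b), y₁ - y₂, y₃ + y₄ - (a + b), y₃ - y₄] 4 +
        ![a, b, c, e, y₁ + y₂ - (a + b), y₁ - y₂, y₃ + y₄ - (a + b), y₃ - y₄] 6 :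
        EuclideanSpace ℝ (Fin 8)) = (2 : ℝ) • x' := by
      simp only [Matrix.cons_val_zero, Matrix.cons_val]
      rw [h2x, two_smul]; abel
    rw [hsum, inner_smul_left, RCLike.conj_to_real, hm]

end config

end Summit.Ventures.PackingBounds.Config.E8Coords
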